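import Literature.NumberTheory.Automorphic.TwistedAsaiPole
import Literature.NumberTheory.Automorphic.AsaiSignArchParityTwist
import HarnessLib

/-!
# Quadratic descent for `GL₂`, line `Sketch` — stub W8: the sign reduction `As⁻ ⊗ χ = As⁺ ⊗ χ ω_{E/F}`

Helper file for the crux `ParityBlindBianchi.QuadraticDescentGL2` (stmt-Langlands-16811), line
`Sketch`, stub `stub_signReduction`.

Setting: `E/F` quadratic with involution `c ≠ 1`, a cuspidal `P` on `GL₂(𝔸_E)` with Asai datum
`(S, A)`, a Hecke character `χ` of `F` unramified off `S` satisfying the central clause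
`e₂(α) χ(ϖ_v)^{f(w|v)} = 1` for almost every place `w` of `E` and every Satake parameter `α` of `P` at
`w` (`v = w ∩ 𝓞 F`).  Claim: there is a Hecke character `χ'` of `F`, again unramified off `S`, again
with the central clause almost everywhere, whose `As⁺`-twisted local factors above every `v ∉ S` are
the `As⁻`-twisted local factors of `χ`:
`P⁺_A(χ'(ϖ_v) x) = P⁻_A(χ(ϖ_v) x)` at `w_v = placeAbove E v`.

Proof (all inputs are theorems of the tree).  Take `χ' = χ η₀` with `η₀` the class-field character of
`E/F` (`exists_isClassFieldCharacter_holds`, file `ExistsClassFieldCharacterHolds`; `E/F` is Galois and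
cyclic of prime degree `2`).
* Above `v ∉ S` every place `w` of `E` is unramified over `F`
  (`HeightOneSpectrum.ramificationIdx_eq_one_of_asai`: the `c`-fixed ones have `f = 2` by the Asai
  datum), so `η₀` is unramified at `v`
  (`IsClassFieldCharacter.isUnramifiedAt_of_ramificationIdxIn_eq_one`), and `χ' = χ η₀` is unramified
  off `S` (`HeckeCharacter.IsUnramifiedAt.mul`).
* Central clause: off the finitely many places above `S` (`tendsto_under_cofinite`), `χ` is unramified at
  `v = w ∩ 𝓞 F`, the old clause gives `e₂(α) χ(ϖ_v)^f = 1`, and `η₀(ϖ_v)^{f} = 1` since `e_v = 1`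
  (`IsTrivialOnNormGroup.valueAtUniformizer_pow_inertiaDegIn`, `inertiaDeg_eq_inertiaDegIn_under`).
* Factors at `w = placeAbove E v`, `v ∉ S`: at a `c`-fixed `w` (inert, `f = 2`) `η₀(ϖ_v) = -1`
  (`IsClassFieldCharacter.valueAtUniformizer_under_eq_neg_one`) and
  `P⁺(A w)(-y) = P⁻(A w)(y)` (`eval_asaiInertPolynomial_units_mul`); at a `c`-moved `w` (split)
  `η₀(ϖ_v) = 1` (`IsTrivialOnNormGroup.valueAtUniformizer_under_eq_one_of_smul_ne`) and the two local
  Asai polynomials coincide (`asaiLocalPolynomial_eq_of_smul_ne`).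
This is "`As⁻(M)` is the twist of `As⁺(M)` by `ω_{k/k₀}`" (Gan–Gross–Prasad, §7) on the tree's local
factors, as in `partialAsaiLTwist_quadraticSign` (file `TwistedAsaiPole`).
-/

set_option linter.dupNamespace false -- `Summit.Langlands.Langlands` is the mandated namespace (lakefile weak option)

noncomputable section

open scoped Classical
open NumberField IsDedekindDomain Polynomial Filter
open Literature.NumberTheory.Automorphic Literature.NumberTheory.GaloisRepresentations

namespace Summit.Langlands.Langlands.Theorems.QuadraticDescentGL2.Sketch

/-- **Stub W8 (sign reduction `As⁻ ⊗ χ = As⁺ ⊗ χ ω_{E/F}`).** For an Asai datum `(S, A)` of a cuspidal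
`P` on `GL₂(𝔸_E)`, `E/F` quadratic with `c ≠ 1`, and a Hecke character `χ` of `F` unramified off `S` with
the central clause a.e.: the character `χ' = χ η₀`, `η₀` the class-field character of `E/F`
(`exists_isClassFieldCharacter_holds`; `η₀` is unramified at the places unramified in `E`, which include
every `v ∉ S` since the `c`-fixed places above `v ∉ S` are inert), is again unramified off `S`, again
satisfies the central clause a.e. (`η₀(ϖ_v)^{f_v} = 1` at a place with `e_v = 1`,
`IsTrivialOnNormGroup.valueAtUniformizer_pow_inertiaDegIn`), and its `As⁺`-factors are the `As⁻`-factors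
of `χ`: `P⁺_A(χ'(ϖ_v) x) = P⁻_A(χ(ϖ_v) x)` above `v ∉ S` (`eval_asaiInertPolynomial_units_mul` with
`η₀(ϖ_v) = -1` at inert, `asaiLocalPolynomial_eq_of_smul_ne` with `η₀(ϖ_v) = 1` at split `v`).
[cite: GanGrossPrasad2012, §7] -/
theorem stub_signReduction :
    ∀ (F E : Type) [Field F] [NumberField F] [Field E] [NumberField E] [Algebra F E] (c : E ≃ₐ[F] E),
      Module.finrank F E = 2 → c ≠ 1 →
      ∀ (hE : isCompact_glFiniteIntegralLevel 2 E) (P : CuspidalAutomorphicRepData 2 E hE)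
        (χ : HeckeCharacter F) (S : Set (HeightOneSpectrum (𝓞 F))) (A : SatakeFamily E),
        P.1.IsAsaiDatum c S A → χ.ramifiedPlaces ⊆ S →
        (∀ᶠ w : HeightOneSpectrum (𝓞 E) in cofinite, ∀ α : Multiset ℂ,
            P.1.HasSatakeParamAt w α → χ.IsUnramifiedAt (w.under (𝓞 F)) →
              α.prod * χ.valueAtUniformizer (w.under (𝓞 F)) ^ w.asIdeal.inertiaDeg (𝓞 F) = 1) →
        ∃ χ' : HeckeCharacter F, χ'.ramifiedPlaces ⊆ S ∧
          (∀ᶠ w : HeightOneSpectrum (𝓞 E) in cofinite, ∀ α : Multiset ℂ,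
            P.1.HasSatakeParamAt w α → χ'.IsUnramifiedAt (w.under (𝓞 F)) →
              α.prod * χ'.valueAtUniformizer (w.under (𝓞 F)) ^ w.asIdeal.inertiaDeg (𝓞 F) = 1) ∧
          ∀ (v : HeightOneSpectrum (𝓞 F)), v ∉ S → ∀ x : ℂ,
            (asaiLocalPolynomial c A 1 (placeAbove E v)).eval (χ'.valueAtUniformizer v * x) =
              (asaiLocalPolynomial c A (-1) (placeAbove E v)).eval (χ.valueAtUniformizer v * x) := by
  intro F E _ _ _ _ _ c h2 hc hE P χ S A hSA hram hχ
  -- `E/F` is Galois, cyclic of prime degree `2`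
  haveI : FiniteDimensional F E := Module.finite_of_finrank_eq_succ h2
  haveI : Algebra.IsQuadraticExtension F E := ⟨h2⟩
  haveI : IsGalois F E := inferInstance
  have hprime : (Module.finrank F E).Prime := by rw [h2]; exact Nat.prime_two
  haveI : Fact (Module.finrank F E).Prime := ⟨hprime⟩
  haveI : IsCyclic (E ≃ₐ[F] E) := isCyclic_of_prime_card (IsGalois.card_aut_eq_finrank F E)
  -- the class-field character `η₀ = ω_{E/F}`
  obtain ⟨η₀, hη₀, -⟩ := exists_isClassFieldCharacter_holds (F := F) (E := E)
  -- above `v ∉ S` every place of `E` is unramified over `F`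
  have heIn : ∀ w : HeightOneSpectrum (𝓞 E), w.under (𝓞 F) ∉ S →
      (w.under (𝓞 F)).asIdeal.ramificationIdxIn (𝓞 E) = 1 := fun w hw => by
    rw [← HeightOneSpectrum.ramificationIdx_eq_ramificationIdxIn_under]
    exact HeightOneSpectrum.ramificationIdx_eq_one_of_asai h2 (hSA.inertiaDeg_eq_two hw)
  -- so `η₀` is unramified at every `v ∉ S`, and so is `χ`
  have hη₀unr : ∀ v : HeightOneSpectrum (𝓞 F), v ∉ S → η₀.IsUnramifiedAt v := fun v hv => by
    have h := heIn (placeAbove E v) (by rw [placeAbove_under]; exact hv)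
    rw [placeAbove_under] at h
    exact hη₀.isUnramifiedAt_of_ramificationIdxIn_eq_one hprime h
  have hχunr : ∀ v : HeightOneSpectrum (𝓞 F), v ∉ S → χ.IsUnramifiedAt v := fun v hv => by
    by_contra h
    exact hv (hram h)
  -- `η₀(ϖ_v)^{f(w|v)} = 1` above `v ∉ S`
  have hη₀pow : ∀ w : HeightOneSpectrum (𝓞 E), w.under (𝓞 F) ∉ S →
      η₀.valueAtUniformizer (w.under (𝓞 F)) ^ w.asIdeal.inertiaDeg (𝓞 F) = 1 := fun w hw => by
    rw [inertiaDeg_eq_inertiaDegIn_under]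
    exact hη₀.isTrivialOnNormGroup.valueAtUniformizer_pow_inertiaDegIn E _ (heIn w hw)
  refine ⟨χ * η₀, ?_, ?_, ?_⟩
  · -- `χ η₀` is unramified off `S`
    intro v hv
    by_contra hvS
    exact hv ((hχunr v hvS).mul (hη₀unr v hvS))
  · -- the central clause, off the finitely many places above `S`
    have hSE : ∀ᶠ w : HeightOneSpectrum (𝓞 E) in cofinite, w.under (𝓞 F) ∉ S :=
      (tendsto_under_cofinite (𝓞 F)).eventually hSA.finite.compl_mem_cofinite
    filter_upwards [hχ, hSE] with w hold hw α hα _hunr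
    rw [HeckeCharacter.valueAtUniformizer_mul, mul_pow, hη₀pow w hw, mul_one]
    exact hold α hα (hχunr _ hw)
  · -- the local factors above `v ∉ S`
    intro v hv x
    have hvw : (placeAbove E v).under (𝓞 F) ∉ S := by rw [placeAbove_under]; exact hv
    rw [HeckeCharacter.valueAtUniformizer_mul]
    by_cases hcw : c • placeAbove E v = placeAbove E v
    · -- inert: `η₀(ϖ_v) = -1` and `P⁺(α)(-y) = P⁻(α)(y)`
      have hval : η₀.valueAtUniformizer v = -1 := by
        have h := hη₀.valueAtUniformizer_under_eq_neg_one h2 (hSA.inertiaDeg_eq_two hvw hcw)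
        rwa [placeAbove_under] at h
      have key := eval_asaiInertPolynomial_units_mul 1 (-1) (A (placeAbove E v))
        (χ.valueAtUniformizer v * x)
      simp only [Units.val_neg, Units.val_one, Int.cast_neg, Int.cast_one, neg_one_mul, mul_one] at key
      rw [asaiLocalPolynomial_of_smul_eq A 1 hcw, asaiLocalPolynomial_of_smul_eq A (-1) hcw, hval,
        mul_neg_one, neg_mul, key]
    · -- split: `η₀(ϖ_v) = 1` and the two local Asai polynomials coincide
      have hval : η₀.valueAtUniformizer v = 1 := by
        have h := hη₀.isTrivialOnNormGroup.valueAtUniformizer_under_eq_one_of_smul_ne h2 hcw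
        rwa [placeAbove_under] at h
      rw [hval, mul_one, asaiLocalPolynomial_eq_of_smul_ne A 1 (-1) hcw]

end Summit.Langlands.Langlands.Theorems.QuadraticDescentGL2.Sketch

end
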